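import Summits.CriticalPhenomena.PercolationContinuityZ3.Theorems.PercNearOneGluingNoHeavyLowerTailSunflowerLawJoinCertificate
import HarnessLib

/-!
# `NoHeavyLowerTail` (crux stmt-CriticalPhenomena-4575), abstract sunflower cubic: (C1) `max(a,b)·(ab − e₂) ≥ e₃` ON THE FOUR-POINT PENCIL
# FAMILY `PC(z∧x₁, z∧x₂, x₃ ∨ x₁x₂)` — gen-31 memo BK-STRATUM-GEN31 §5 made formal

Support file (seat `prim-ineq-gen-2` gen 32; `--supports stmt-CriticalPhenomena-4575`).  Nothing is asserted about the crux; no `sorry`, no named facts,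
no definitions, standard axioms.  Memo: run/shared/lean/prim/prim-ineq-gen-2/CUBIC-SIGN-LAW-GEN32.md §3 (and BK-STRATUM-GEN31.md §5).

THE STRUCTURE.  Coins `x₁, x₂, x₃, z` with biases `p₁, p₂, p₃, t` (`q_i = 1 − p_i`); the product-class structure `PC(W)` of the three up-sets
`W₁ = z ∧ x₁`, `W₂ = z ∧ x₂`, `W₃ = x₃ ∨ x₁x₂` (label `B` = none occurs, `C_k` = only `W_k`, `A` = at least two).  Cells:
`a = t·(p₁p₂ + p₃(p₁q₂ + q₁p₂))`, `c₁ = t·p₁q₂q₃`, `c₂ = t·q₁p₂q₃`, `c₃ = (1−t)(p₃ + q₃p₁p₂) + t·q₁q₂p₃`, `b = (1−t)q₃(1 − p₁p₂) + t·q₁q₂q₃`.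
Together with `…SunflowerFourPointSixPetal` (the graded `K₄` classes) this is the second and last non-BK bi-saturated family on four points
(gen-31 census §4: 122 bi-saturated structures = 59 BK + 12 copies of this family + 51 graded-`K₄` colourings), so — with the BK strata
(`…SunflowerBKStratum`) and the bi-saturation reduction (`…SunflowerLawSaturation[Reduction]`) — (C1) holds for EVERY three-petal sunflower of
up-sets on at most four coordinates (memo §3; the enumeration itself is a machine census, not in Lean).

PROOF (`pencilFamily_C1`): exact identities `AG = ab − e₂ = p₁p₂q₁q₂q₃·t·(1 − t q₃) ≥ 0`, `LA = a·AG − e₃ = t²·(M − Q)·p₁p₂p₃q₁q₂q₃` with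
`M − Q = p₁p₂ − q₁q₂ + p₃(1 − p₁p₂)`, `LB = b·AG − e₃ = q₃²·t(1−t)·q₁q₂·p₁p₂·((1 − p₁p₂) − t(p₁p₂ + p₁q₂ + q₁p₂))`, `a − b = t(M−Q) − (1−t)q₃(1−p₁p₂)`;
hence `a ≥ b ⟹ M ≥ Q ⟹ LA ≥ 0`, and if `a ≤ b`: either `M ≥ Q` (then `LB = LA + (b−a)AG ≥ 0`) or `M < Q`, which forces `p₁p₂ < q₁q₂` and then the
last factor of `LB` is `≥ q₁q₂ − p₁p₂ > 0`.  All identities are `ring`.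
-/

namespace Summit.CriticalPhenomena.PercolationContinuityZ3.Theorems.SunflowerPartition

namespace FourPointPencilFamily

variable {p₁ p₂ p₃ t q₁ q₂ q₃ a b c₁ c₂ c₃ : ℝ}

/-- `AG = ab − e₂(c) = p₁p₂q₁q₂q₃·t·(1 − t·q₃)` on the pencil family. [this work] -/
theorem pencilFamily_AG_eq (hq₁ : q₁ = 1 - p₁) (hq₂ : q₂ = 1 - p₂) (hq₃ : q₃ = 1 - p₃)
    (ha : a = t * (p₁ * p₂ + p₃ * (p₁ * q₂ + q₁ * p₂))) (hb : b = (1 - t) * q₃ * (1 - p₁ * p₂) + t * (q₁ * q₂ * q₃))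
    (hc₁ : c₁ = t * (p₁ * q₂ * q₃)) (hc₂ : c₂ = t * (q₁ * p₂ * q₃)) (hc₃ : c₃ = (1 - t) * (p₃ + q₃ * (p₁ * p₂)) + t * (q₁ * q₂ * p₃)) :
    a * b - (c₁ * c₂ + c₁ * c₃ + c₂ * c₃) = p₁ * p₂ * q₁ * q₂ * q₃ * t * (1 - t * q₃) := by
  rw [ha, hb, hc₁, hc₂, hc₃, hq₁, hq₂, hq₃]; ring

/-- `LA = a·AG − e₃ = t²·(M − Q)·p₁p₂p₃q₁q₂q₃`, `M − Q = p₁p₂ − q₁q₂ + p₃(1 − p₁p₂)` (`= (a−b)·AG` of `PC(x₁,x₂,x₃)` times `t²`). [this work] -/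
theorem pencilFamily_LA_eq (hq₁ : q₁ = 1 - p₁) (hq₂ : q₂ = 1 - p₂) (hq₃ : q₃ = 1 - p₃)
    (ha : a = t * (p₁ * p₂ + p₃ * (p₁ * q₂ + q₁ * p₂))) (hb : b = (1 - t) * q₃ * (1 - p₁ * p₂) + t * (q₁ * q₂ * q₃))
    (hc₁ : c₁ = t * (p₁ * q₂ * q₃)) (hc₂ : c₂ = t * (q₁ * p₂ * q₃)) (hc₃ : c₃ = (1 - t) * (p₃ + q₃ * (p₁ * p₂)) + t * (q₁ * q₂ * p₃)) :
    a * (a * b - (c₁ * c₂ + c₁ * c₃ + c₂ * c₃)) - c₁ * c₂ * c₃ =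
      t ^ 2 * (p₁ * p₂ - q₁ * q₂ + p₃ * (1 - p₁ * p₂)) * (p₁ * p₂ * p₃ * q₁ * q₂ * q₃) := by
  rw [ha, hb, hc₁, hc₂, hc₃, hq₁, hq₂, hq₃]; ring

/-- `LB = b·AG − e₃ = q₃²·t(1−t)·q₁q₂·p₁p₂·((1 − p₁p₂) − t(p₁p₂ + p₁q₂ + q₁p₂))`. [this work] -/
theorem pencilFamily_LB_eq (hq₁ : q₁ = 1 - p₁) (hq₂ : q₂ = 1 - p₂) (hq₃ : q₃ = 1 - p₃)
    (ha : a = t * (p₁ * p₂ + p₃ * (p₁ * q₂ + q₁ * p₂))) (hb : b = (1 - t) * q₃ * (1 - p₁ * p₂) + t * (q₁ * q₂ * q₃))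
    (hc₁ : c₁ = t * (p₁ * q₂ * q₃)) (hc₂ : c₂ = t * (q₁ * p₂ * q₃)) (hc₃ : c₃ = (1 - t) * (p₃ + q₃ * (p₁ * p₂)) + t * (q₁ * q₂ * p₃)) :
    b * (a * b - (c₁ * c₂ + c₁ * c₃ + c₂ * c₃)) - c₁ * c₂ * c₃ =
      q₃ ^ 2 * t * (1 - t) * (q₁ * q₂) * (p₁ * p₂) * ((1 - p₁ * p₂) - t * (p₁ * p₂ + p₁ * q₂ + q₁ * p₂)) := by
  rw [ha, hb, hc₁, hc₂, hc₃, hq₁, hq₂, hq₃]; ring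

/-- `a − b = t·(M − Q) − (1 − t)·q₃·(1 − p₁p₂)`. [this work] -/
theorem pencilFamily_a_sub_b (hq₁ : q₁ = 1 - p₁) (hq₂ : q₂ = 1 - p₂) (hq₃ : q₃ = 1 - p₃)
    (ha : a = t * (p₁ * p₂ + p₃ * (p₁ * q₂ + q₁ * p₂))) (hb : b = (1 - t) * q₃ * (1 - p₁ * p₂) + t * (q₁ * q₂ * q₃)) :
    a - b = t * (p₁ * p₂ - q₁ * q₂ + p₃ * (1 - p₁ * p₂)) - (1 - t) * q₃ * (1 - p₁ * p₂) := by
  rw [ha, hb, hq₁, hq₂, hq₃]; ring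

/-- **(C1) ON THE FOUR-POINT PENCIL FAMILY** `PC(z∧x₁, z∧x₂, x₃ ∨ x₁x₂)`: `e₃(c) ≤ max(a,b)·(ab − e₂(c))` for all biases in `[0,1]`. [this work] -/
theorem pencilFamily_C1 (hp₁ : 0 ≤ p₁) (hp₁' : p₁ ≤ 1) (hp₂ : 0 ≤ p₂) (hp₂' : p₂ ≤ 1) (hp₃ : 0 ≤ p₃) (hp₃' : p₃ ≤ 1)
    (ht : 0 ≤ t) (ht' : t ≤ 1) (hq₁ : q₁ = 1 - p₁) (hq₂ : q₂ = 1 - p₂) (hq₃ : q₃ = 1 - p₃)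
    (ha : a = t * (p₁ * p₂ + p₃ * (p₁ * q₂ + q₁ * p₂))) (hb : b = (1 - t) * q₃ * (1 - p₁ * p₂) + t * (q₁ * q₂ * q₃))
    (hc₁ : c₁ = t * (p₁ * q₂ * q₃)) (hc₂ : c₂ = t * (q₁ * p₂ * q₃)) (hc₃ : c₃ = (1 - t) * (p₃ + q₃ * (p₁ * p₂)) + t * (q₁ * q₂ * p₃)) :
    c₁ * c₂ * c₃ ≤ max a b * (a * b - (c₁ * c₂ + c₁ * c₃ + c₂ * c₃)) := by
  have hAG := pencilFamily_AG_eq hq₁ hq₂ hq₃ ha hb hc₁ hc₂ hc₃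
  have hLA := pencilFamily_LA_eq hq₁ hq₂ hq₃ ha hb hc₁ hc₂ hc₃
  have hLB := pencilFamily_LB_eq hq₁ hq₂ hq₃ ha hb hc₁ hc₂ hc₃
  have hab := pencilFamily_a_sub_b hq₁ hq₂ hq₃ ha hb
  have hq₁0 : 0 ≤ q₁ := by rw [hq₁]; linarith
  have hq₂0 : 0 ≤ q₂ := by rw [hq₂]; linarith
  have hq₃0 : 0 ≤ q₃ := by rw [hq₃]; linarith
  have hq₃1 : q₃ ≤ 1 := by rw [hq₃]; linarith
  have hP1 : p₁ * p₂ ≤ 1 := by nlinarith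
  -- the three structural factors
  have hπ : 0 ≤ p₁ * p₂ * p₃ * q₁ * q₂ * q₃ := by positivity
  have hAG0 : 0 ≤ a * b - (c₁ * c₂ + c₁ * c₃ + c₂ * c₃) := by
    rw [hAG]
    have : 0 ≤ 1 - t * q₃ := by nlinarith
    positivity
  set D := p₁ * p₂ - q₁ * q₂ + p₃ * (1 - p₁ * p₂) with hD
  rcases le_total b a with hba | hab'
  · -- `a ≥ b`: then `t·D ≥ (1−t)q₃(1−p₁p₂) ≥ 0`, so `LA = t·(t·D)·π ≥ 0`
    rw [max_eq_left hba]
    have h1 : 0 ≤ (1 - t) * q₃ * (1 - p₁ * p₂) := mul_nonneg (mul_nonneg (by linarith) hq₃0) (by linarith)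
    have h2 : 0 ≤ t * D := by linarith
    have h3 : 0 ≤ t ^ 2 * D * (p₁ * p₂ * p₃ * q₁ * q₂ * q₃) := by
      rw [show t ^ 2 * D = t * (t * D) by ring]
      exact mul_nonneg (mul_nonneg ht h2) hπ
    linarith
  · -- `a ≤ b`
    rw [max_eq_right hab']
    rcases le_or_gt 0 D with hD0 | hD0
    · -- `M ≥ Q`: `LA ≥ 0`, and `LB = LA + (b − a)·AG`
      have h3 : 0 ≤ t ^ 2 * D * (p₁ * p₂ * p₃ * q₁ * q₂ * q₃) := mul_nonneg (mul_nonneg (sq_nonneg t) hD0) hπ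
      have key : b * (a * b - (c₁ * c₂ + c₁ * c₃ + c₂ * c₃)) - c₁ * c₂ * c₃ =
          (a * (a * b - (c₁ * c₂ + c₁ * c₃ + c₂ * c₃)) - c₁ * c₂ * c₃) +
            (b - a) * (a * b - (c₁ * c₂ + c₁ * c₃ + c₂ * c₃)) := by ring
      have h4 : 0 ≤ (b - a) * (a * b - (c₁ * c₂ + c₁ * c₃ + c₂ * c₃)) := mul_nonneg (by linarith) hAG0
      linarith
    · -- `M < Q`: then `p₁p₂ < q₁q₂`, and the last factor of `LB` is at least `q₁q₂ − p₁p₂ > 0`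
      have hPR : p₁ * p₂ < q₁ * q₂ := by
        have : 0 ≤ p₃ * (1 - p₁ * p₂) := mul_nonneg hp₃ (by linarith)
        linarith
      have hlast : 0 ≤ (1 - p₁ * p₂) - t * (p₁ * p₂ + p₁ * q₂ + q₁ * p₂) := by
        have e : (1 - p₁ * p₂) - (p₁ * p₂ + p₁ * q₂ + q₁ * p₂) = q₁ * q₂ - p₁ * p₂ := by rw [hq₁, hq₂]; ring
        have hs : 0 ≤ p₁ * p₂ + p₁ * q₂ + q₁ * p₂ := by positivity
        nlinarith
      rw [← sub_nonneg, hLB]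
      have : 0 ≤ q₃ ^ 2 * t * (1 - t) * (q₁ * q₂) * (p₁ * p₂) :=
        mul_nonneg (mul_nonneg (mul_nonneg (mul_nonneg (sq_nonneg _) ht) (by linarith)) (mul_nonneg hq₁0 hq₂0))
          (mul_nonneg hp₁ hp₂)
      exact mul_nonneg this hlast

end FourPointPencilFamily

end Summit.CriticalPhenomena.PercolationContinuityZ3.Theorems.SunflowerPartition
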